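import Summits.CriticalPhenomena.PercolationContinuityZ3.Theorems.Transplant.FKConnectivityAllQForestAdjacentPathGadgetResClass
import Summits.CriticalPhenomena.PercolationContinuityZ3.Theorems.Transplant.FKConnectivityAllQForestAdjacentPathGadgetReglue
import HarnessLib

/-!
# The path gadget: the product step — the doubly-`pq` residual from the two one-side sign facts

builds on p205010 (kernel theorem, internal audit signed; external expert review pending).  No definitions, no named facts, no sorries;
standard axioms.

Separator `S = {o, p, q}` with the PATH gadget `{op, oq}` (both free; memo bschramm/FROM-fk-1-g20-SEPARATOR-EXCHANGE.md §3).  The node's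
inequality across such a separator is equivalent (`…SeparatorResidual`, `…PathGadgetResidual`) to `bad ≤ good` on the DOUBLY-`pq`
residual colourings, which (`…PathGadgetResClass`) are of type `(d, pq | pq, d)` or `(pq, d | d, pq)` with one gadget pair in each class.
HYPOTHESES (the level-one sign facts of the two sides, as injections — memo §3(iii), §6 item 2): `J₁` maps the side-1 colourings of type
`(pq, d)` (first class contains `e`, joins exactly `p, q`; partner discrete) injectively to those of type `(d, pq)`; `J₂` maps the side-2
colourings of type `(pq, d)` with `f` in the first class injectively to those of type `(d, pq)` with `f` in the first class.
* **`adjForestNoSq_fibre_pathGadget_res_le`** — then `#(bad ∩ R ∩ Res) ≤ #(good ∩ R ∩ Res)`: an explicit injection (re-glue `J₁` of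
  side 1 with the flipped side 2; or, on the image of `J₁`, un-glue; or re-glue the flipped `J₂` of side 2 — the "rearrangement" of
  memo §3), valid by the rank-one gluing lemma of `…GlueRankOne`.
[cite: Grimmett2006, §1.5 (p. 13); §3.8 (pp. 61–62); §4.2 Lemma (4.13)] [cite: SempleWelsh2008, Conj. 1.1 (p. 2)] [cite: Linusson2011, Prop. 2.6]
-/

noncomputable section

namespace Summit.CriticalPhenomena.PercolationContinuityZ3.Theorems

namespace FK

open Set SimpleGraph Literature.Probability.LatticeModels Literature.Probability.Percolation
open scoped Classical

variable {V : Type*} [Fintype V]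

section PathGadgetProduct

open scoped symmDiff

variable {E₁ E₂ : Set (Sym2 V)} {V₁ V₂ : Set V} {M u₀ : BondConfig V} {o p q v y : V}

/-- **The product step** (memo §3 "rearrangement", §6 item 2): with the side fibres `M₁ = M' ∩ E₁`, `M₂ = M' ∩ E₂`, if `J₁` injects
the side-1 colourings of type (`pq`, `d`) (sets `T₁ → T₁'`) and `J₂` the side-2 colourings with `f` of type (`pq`, `d`) (`T₂ → T₂'`),
then on the doubly-`pq` residual colourings `#bad ≤ #good`. [cite: SempleWelsh2008, Conj. 1.1 (p. 2)] [cite: Linusson2011, Prop. 2.6] -/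
theorem adjForestNoSq_fibre_pathGadget_res_le (hop : o ≠ p) (hoq : o ≠ q) (hpq : p ≠ q)
    (h₁ : ∀ e ∈ E₁, ∀ z ∈ e, z ∈ V₁) (h₂ : ∀ e ∈ E₂, ∀ z ∈ e, z ∈ V₂) (hS : V₁ ∩ V₂ ⊆ ({o, p, q} : Set V))
    (hd : Disjoint E₁ E₂) (hn₁ : ∀ x ∈ ({o, p, q} : Set V), ∀ x' ∈ ({o, p, q} : Set V), s(x, x') ∉ E₁)
    (hn₂ : ∀ x ∈ ({o, p, q} : Set V), ∀ x' ∈ ({o, p, q} : Set V), s(x, x') ∉ E₂)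
    (heE : s(o, v) ∈ E₁) (hfE : s(o, y) ∈ E₂)
    (hM' : insert s(o, y) (insert s(o, v) M) ∪ u₀ ⊆ ({s(o, p), s(o, q)} : Set (Sym2 V)) ∪ (E₁ ∪ E₂))
    (hgp : s(o, p) ∈ insert s(o, y) (insert s(o, v) M)) (hgq : s(o, q) ∈ insert s(o, y) (insert s(o, v) M))
    (Rset Res : Set (BondConfig V))
    (hRset : ∀ ω, ω ∈ Rset ↔
      ((¬ ∀ x ∈ ({o, p, q} : Set V), ∀ x' ∈ ({o, p, q} : Set V),
        (openGraph (ω ∩ E₁)).Reachable x x' ↔ (openGraph ((ω ∆ insert s(o, y) (insert s(o, v) M)) ∩ E₁)).Reachable x x') ∧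
      (¬ ∀ x ∈ ({o, p, q} : Set V), ∀ x' ∈ ({o, p, q} : Set V),
        (openGraph (ω ∩ E₂)).Reachable x x' ↔ (openGraph ((ω ∆ insert s(o, y) (insert s(o, v) M)) ∩ E₂)).Reachable x x')))
    (hRes : ∀ ω, ω ∈ Res ↔
      (((openGraph (ω ∩ E₂)).Reachable p q ∧ (openGraph ((ω ∆ insert s(o, y) (insert s(o, v) M)) ∩ E₁)).Reachable p q) ∨
      ((openGraph (ω ∩ E₁)).Reachable p q ∧ (openGraph ((ω ∆ insert s(o, y) (insert s(o, v) M)) ∩ E₂)).Reachable p q)))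
    (T₁ T₁' : Set (BondConfig V))
    (hT₁ : ∀ X, X ∈ T₁ ↔ X ⊆ E₁ ∧ X \ (insert s(o, y) (insert s(o, v) M) ∩ E₁) = u₀ ∩ E₁ ∧ IsForestCfg X ∧
      IsForestCfg (X ∆ (insert s(o, y) (insert s(o, v) M) ∩ E₁)) ∧ s(o, v) ∈ X ∧
      ((openGraph X).Reachable p q ∧ ¬ (openGraph X).Reachable o p ∧ ¬ (openGraph X).Reachable o q) ∧
      (∀ x ∈ ({o, p, q} : Set V), ∀ x' ∈ ({o, p, q} : Set V),
        (openGraph (X ∆ (insert s(o, y) (insert s(o, v) M) ∩ E₁))).Reachable x x' → x = x'))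
    (hT₁' : ∀ X, X ∈ T₁' ↔ X ⊆ E₁ ∧ X \ (insert s(o, y) (insert s(o, v) M) ∩ E₁) = u₀ ∩ E₁ ∧ IsForestCfg X ∧
      IsForestCfg (X ∆ (insert s(o, y) (insert s(o, v) M) ∩ E₁)) ∧ s(o, v) ∈ X ∧
      (∀ x ∈ ({o, p, q} : Set V), ∀ x' ∈ ({o, p, q} : Set V), (openGraph X).Reachable x x' → x = x') ∧
      ((openGraph (X ∆ (insert s(o, y) (insert s(o, v) M) ∩ E₁))).Reachable p q ∧
        ¬ (openGraph (X ∆ (insert s(o, y) (insert s(o, v) M) ∩ E₁))).Reachable o p ∧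
        ¬ (openGraph (X ∆ (insert s(o, y) (insert s(o, v) M) ∩ E₁))).Reachable o q))
    (T₂ T₂' : Set (BondConfig V))
    (hT₂ : ∀ Y, Y ∈ T₂ ↔ Y ⊆ E₂ ∧ Y \ (insert s(o, y) (insert s(o, v) M) ∩ E₂) = u₀ ∩ E₂ ∧ IsForestCfg Y ∧
      IsForestCfg (Y ∆ (insert s(o, y) (insert s(o, v) M) ∩ E₂)) ∧ s(o, y) ∈ Y ∧
      ((openGraph Y).Reachable p q ∧ ¬ (openGraph Y).Reachable o p ∧ ¬ (openGraph Y).Reachable o q) ∧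
      (∀ x ∈ ({o, p, q} : Set V), ∀ x' ∈ ({o, p, q} : Set V),
        (openGraph (Y ∆ (insert s(o, y) (insert s(o, v) M) ∩ E₂))).Reachable x x' → x = x'))
    (hT₂' : ∀ Y, Y ∈ T₂' ↔ Y ⊆ E₂ ∧ Y \ (insert s(o, y) (insert s(o, v) M) ∩ E₂) = u₀ ∩ E₂ ∧ IsForestCfg Y ∧
      IsForestCfg (Y ∆ (insert s(o, y) (insert s(o, v) M) ∩ E₂)) ∧ s(o, y) ∈ Y ∧
      (∀ x ∈ ({o, p, q} : Set V), ∀ x' ∈ ({o, p, q} : Set V), (openGraph Y).Reachable x x' → x = x') ∧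
      ((openGraph (Y ∆ (insert s(o, y) (insert s(o, v) M) ∩ E₂))).Reachable p q ∧
        ¬ (openGraph (Y ∆ (insert s(o, y) (insert s(o, v) M) ∩ E₂))).Reachable o p ∧
        ¬ (openGraph (Y ∆ (insert s(o, y) (insert s(o, v) M) ∩ E₂))).Reachable o q))
    (J₁ J₂ : BondConfig V → BondConfig V) (hJ₁ : ∀ X ∈ T₁, J₁ X ∈ T₁') (hJ₁i : InjOn J₁ T₁)
    (hJ₂ : ∀ Y ∈ T₂, J₂ Y ∈ T₂') (hJ₂i : InjOn J₂ T₂) :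
    fibreCount (insert s(o, y) (insert s(o, v) M)) u₀ (forestEv V ∩ {ω | s(o, v) ∈ ω ∧ s(o, y) ∈ ω} ∩ (Rset ∩ Res)) (forestEv V) ≤
      fibreCount (insert s(o, y) (insert s(o, v) M)) u₀ (forestEv V ∩ {ω | s(o, v) ∈ ω} ∩ (Rset ∩ Res))
        (forestEv V ∩ {ω | s(o, y) ∈ ω}) := by
  -- ### notation
  set M' : BondConfig V := insert s(o, y) (insert s(o, v) M) with hM'def
  set ES : Set (Sym2 V) := {s(o, p), s(o, q)} with hESdef
  set M₁ : BondConfig V := M' ∩ E₁ with hM₁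
  set M₂ : BondConfig V := M' ∩ E₂ with hM₂
  have ho3 : o ∈ ({o, p, q} : Set V) := mem_insert _ _
  have hp3 : p ∈ ({o, p, q} : Set V) := mem_insert_of_mem _ (mem_insert _ _)
  have hq3 : q ∈ ({o, p, q} : Set V) := mem_insert_of_mem _ (mem_insert_of_mem _ rfl)
  have hES₁ : Disjoint ES E₁ := pathGadget_disjoint_of_noPair hn₁
  have hES₂ : Disjoint ES E₂ := pathGadget_disjoint_of_noPair hn₂
  have hESM : ES ⊆ M' := fun g hg => by
    rcases hg with rfl | hg; exacts [hgp, by rw [mem_singleton_iff.1 hg]; exact hgq]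
  have hM'sub : M' ⊆ ES ∪ (E₁ ∪ E₂) := fun x hx => hM' (Or.inl hx)
  have hu₀sub : u₀ ⊆ ES ∪ (E₁ ∪ E₂) := fun x hx => hM' (Or.inr hx)
  have heM : s(o, v) ∈ M' := mem_insert_of_mem _ (mem_insert _ _)
  have hfM : s(o, y) ∈ M' := mem_insert _ _
  have hfM₂ : s(o, y) ∈ M₂ := ⟨hfM, hfE⟩
  have part₁ : ∀ (W : BondConfig V), (W ∆ M') ∩ E₁ = (W ∩ E₁) ∆ M₁ := fun W => by
    rw [inter_comm, Set.inter_symmDiff_distrib_left, inter_comm E₁ W, inter_comm E₁ M']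
  have part₂ : ∀ (W : BondConfig V), (W ∆ M') ∩ E₂ = (W ∩ E₂) ∆ M₂ := fun W => by
    rw [inter_comm, Set.inter_symmDiff_distrib_left, inter_comm E₂ W, inter_comm E₂ M']
  have fib : ∀ {ω : BondConfig V}, ω \ M' = u₀ → ω ⊆ ES ∪ (E₁ ∪ E₂) ∧ Disjoint u₀ M' ∧
      (ω ∩ E₁) \ M₁ = u₀ ∩ E₁ ∧ (ω ∩ E₂) \ M₂ = u₀ ∩ E₂ ∧ ω = ω ∩ E₁ ∪ ω ∩ ES ∪ ω ∩ E₂ := by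
    intro ω hω
    have hsub : ω ⊆ ES ∪ (E₁ ∪ E₂) := fun x hx => by
      by_cases hxM : x ∈ M'
      · exact hM'sub hxM
      · exact hu₀sub (hω ▸ ⟨hx, hxM⟩)
    have hdis : Disjoint u₀ M' := Set.disjoint_left.2 fun x hx hxM => (hω ▸ hx : x ∈ ω \ M').2 hxM
    have hin : ∀ {x}, x ∈ ω → x ∉ M' → x ∈ u₀ := fun hx hxM => by rw [← hω]; exact ⟨hx, hxM⟩
    have hout : ∀ {x}, x ∈ u₀ → x ∈ ω ∧ x ∉ M' := fun hx => by rw [← hω] at hx; exact hx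
    refine ⟨hsub, hdis, ?_, ?_, ?_⟩
    · ext x; constructor
      · rintro ⟨⟨hxω, hx1⟩, hxM⟩; exact ⟨hin hxω fun h => hxM ⟨h, hx1⟩, hx1⟩
      · rintro ⟨hxu, hx1⟩; exact ⟨⟨(hout hxu).1, hx1⟩, fun h => (hout hxu).2 h.1⟩
    · ext x; constructor
      · rintro ⟨⟨hxω, hx2⟩, hxM⟩; exact ⟨hin hxω fun h => hxM ⟨h, hx2⟩, hx2⟩
      · rintro ⟨hxu, hx2⟩; exact ⟨⟨(hout hxu).1, hx2⟩, fun h => (hout hxu).2 h.1⟩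
    · ext x; constructor
      · intro hx
        rcases hsub hx with h | h | h
        · exact Or.inl (Or.inr ⟨hx, h⟩)
        · exact Or.inl (Or.inl ⟨hx, h⟩)
        · exact Or.inr ⟨hx, h⟩
      · rintro ((h | h) | h) <;> exact h.1
  have glued : ∀ {X' G Y' : BondConfig V}, X' ⊆ E₁ → G ⊆ ES → Y' ⊆ E₂ →
      (X' ∪ G ∪ Y') ∩ E₁ = X' ∧ (X' ∪ G ∪ Y') ∩ ES = G ∧ (X' ∪ G ∪ Y') ∩ E₂ = Y' ∧
      (X' ∪ G ∪ Y') ∆ M' ⊆ (X' ∆ M₁) ∪ (G ∆ ES) ∪ (Y' ∆ M₂) := by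
    intro X' G Y' hX hG hY
    have d1 : ∀ x, x ∈ E₁ → x ∉ ES ∧ x ∉ E₂ := fun x hx =>
      ⟨fun h => Set.disjoint_left.1 hES₁ h hx, fun h => Set.disjoint_left.1 hd hx h⟩
    have d2 : ∀ x, x ∈ E₂ → x ∉ ES ∧ x ∉ E₁ := fun x hx =>
      ⟨fun h => Set.disjoint_left.1 hES₂ h hx, fun h => Set.disjoint_left.1 hd h hx⟩
    have dS : ∀ x, x ∈ ES → x ∉ E₁ ∧ x ∉ E₂ := fun x hx =>
      ⟨fun h => Set.disjoint_left.1 hES₁ hx h, fun h => Set.disjoint_left.1 hES₂ hx h⟩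
    refine ⟨?_, ?_, ?_, ?_⟩
    · ext x; constructor
      · rintro ⟨(h | h) | h, hx1⟩
        · exact h
        · exact absurd hx1 (dS x (hG h)).1
        · exact absurd hx1 (d2 x (hY h)).2
      · exact fun h => ⟨Or.inl (Or.inl h), hX h⟩
    · ext x; constructor
      · rintro ⟨(h | h) | h, hxS⟩
        · exact absurd hxS (d1 x (hX h)).1
        · exact h
        · exact absurd hxS (d2 x (hY h)).1
      · exact fun h => ⟨Or.inl (Or.inr h), hG h⟩
    · ext x; constructor
      · rintro ⟨(h | h) | h, hx2⟩
        · exact absurd hx2 (d1 x (hX h)).2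
        · exact absurd hx2 (dS x (hG h)).2
        · exact h
      · exact fun h => ⟨Or.inr h, hY h⟩
    · intro x hx
      rcases Set.mem_symmDiff.1 hx with ⟨hxW, hxM⟩ | ⟨hxM, hxW⟩
      · rcases hxW with (h | h) | h
        · exact Or.inl (Or.inl (Set.mem_symmDiff.2 (Or.inl ⟨h, fun h' => hxM h'.1⟩)))
        · exact absurd (hESM (hG h)) hxM
        · exact Or.inr (Set.mem_symmDiff.2 (Or.inl ⟨h, fun h' => hxM h'.1⟩))
      · rcases hM'sub hxM with h | h | h
        · exact Or.inl (Or.inr (Set.mem_symmDiff.2 (Or.inr ⟨h, fun h' => hxW (Or.inl (Or.inr h'))⟩)))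
        · exact Or.inl (Or.inl (Set.mem_symmDiff.2 (Or.inr ⟨⟨hxM, h⟩, fun h' => hxW (Or.inl (Or.inl h'))⟩)))
        · exact Or.inr (Set.mem_symmDiff.2 (Or.inr ⟨⟨hxM, h⟩, fun h' => hxW (Or.inr h')⟩))
  have gluedFib : ∀ {X' G Y' : BondConfig V}, X' ⊆ E₁ → G ⊆ ES → Y' ⊆ E₂ → Disjoint u₀ M' →
      X' \ M₁ = u₀ ∩ E₁ → Y' \ M₂ = u₀ ∩ E₂ → (X' ∪ G ∪ Y') \ M' = u₀ := by
    intro X' G Y' hX hG hY hdis hX' hY'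
    ext x; constructor
    · rintro ⟨(h | h) | h, hxM⟩
      · exact ((hX'.le ⟨h, fun h' => hxM h'.1⟩ : x ∈ u₀ ∩ E₁)).1
      · exact absurd (hESM (hG h)) hxM
      · exact ((hY'.le ⟨h, fun h' => hxM h'.1⟩ : x ∈ u₀ ∩ E₂)).1
    · intro hxu
      have hxM : x ∉ M' := fun h => Set.disjoint_left.1 hdis hxu h
      refine ⟨?_, hxM⟩
      rcases hu₀sub hxu with h | h | h
      · exact absurd (hESM h) hxM
      · exact Or.inl (Or.inl ((hX'.ge ⟨hxu, h⟩ : x ∈ X' \ M₁).1))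
      · exact Or.inr ((hY'.ge ⟨hxu, h⟩ : x ∈ Y' \ M₂).1)
  have gadc : ∀ {ω : BondConfig V}, (s(o, p) ∈ ω ↔ s(o, q) ∉ ω) →
      ∃ c c' : V, (c = p ∨ c = q) ∧ (c' = p ∨ c' = q) ∧ c ≠ c' ∧ ω ∩ ES = {s(o, c)} ∧ ({s(o, c)} : Set (Sym2 V)) ∆ ES = {s(o, c')} := by
    intro ω hgad
    have hne : s(o, p) ≠ s(o, q) := fun h => by
      rcases Sym2.eq_iff.1 h with ⟨-, h⟩ | ⟨h, -⟩
      · exact hpq h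
      · exact hoq h
    by_cases hp : s(o, p) ∈ ω
    · refine ⟨p, q, Or.inl rfl, Or.inr rfl, hpq, ?_, ?_⟩
      · ext x; constructor
        · rintro ⟨hx, hxS | hxS⟩
          · exact hxS
          · exact absurd (mem_singleton_iff.1 hxS ▸ hx) (hgad.1 hp)
        · intro hx; rw [mem_singleton_iff.1 hx]; exact ⟨hp, mem_insert _ _⟩
      · ext x; rw [Set.mem_symmDiff, mem_singleton_iff, mem_singleton_iff]; constructor
        · rintro (⟨rfl, h⟩ | ⟨h, h'⟩)
          · exact absurd (mem_insert _ _) h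
          · rcases h with h | h
            · exact absurd h h'
            · exact mem_singleton_iff.1 h
        · rintro rfl; exact Or.inr ⟨mem_insert_of_mem _ rfl, hne.symm⟩
    · have hq : s(o, q) ∈ ω := not_not.1 fun h => hp (hgad.2 h)
      refine ⟨q, p, Or.inr rfl, Or.inl rfl, hpq.symm, ?_, ?_⟩
      · ext x; constructor
        · rintro ⟨hx, hxS | hxS⟩
          · exact absurd (hxS ▸ hx) hp
          · exact hxS
        · intro hx; rw [mem_singleton_iff.1 hx]; exact ⟨hq, mem_insert_of_mem _ rfl⟩
      · ext x; rw [Set.mem_symmDiff, mem_singleton_iff, mem_singleton_iff]; constructor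
        · rintro (⟨rfl, h⟩ | ⟨h, h'⟩)
          · exact absurd (mem_insert_of_mem _ rfl) h
          · rcases h with h | h
            · exact h
            · exact absurd (mem_singleton_iff.1 h) h'
        · rintro rfl; exact Or.inr ⟨mem_insert _ _, hne⟩
  set Θ : BondConfig V → BondConfig V := fun ω =>
    if (openGraph (ω ∩ E₁)).Reachable p q then J₁ (ω ∩ E₁) ∪ ω ∩ ES ∪ (ω ∆ M') ∩ E₂
    else if h : ∃ X, X ∈ T₁ ∧ J₁ X = ω ∩ E₁ then Classical.choose h ∪ ω ∩ ES ∪ (ω ∆ M') ∩ E₂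
    else ω ∩ E₁ ∪ ω ∩ ES ∪ (J₂ (ω ∩ E₂)) ∆ M₂ with hΘdef
  have verify : ∀ {ω : BondConfig V} {X' G Y' : BondConfig V}, ω \ M' = u₀ →
      X' ⊆ E₁ → G = ω ∩ ES → Y' ⊆ E₂ → X' \ M₁ = u₀ ∩ E₁ → Y' \ M₂ = u₀ ∩ E₂ →
      IsForestCfg X' → IsForestCfg (X' ∆ M₁) → IsForestCfg Y' → IsForestCfg (Y' ∆ M₂) → s(o, v) ∈ X' → s(o, y) ∉ Y' →
      (s(o, p) ∈ ω ↔ s(o, q) ∉ ω) →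
      (((∀ x ∈ ({o, p, q} : Set V), ∀ x' ∈ ({o, p, q} : Set V), (openGraph X').Reachable x x' → x = x') ∧
          ((openGraph (X' ∆ M₁)).Reachable p q ∧ ¬ (openGraph (X' ∆ M₁)).Reachable o p ∧ ¬ (openGraph (X' ∆ M₁)).Reachable o q) ∧
          ((openGraph Y').Reachable p q ∧ ¬ (openGraph Y').Reachable o p ∧ ¬ (openGraph Y').Reachable o q) ∧
          (∀ x ∈ ({o, p, q} : Set V), ∀ x' ∈ ({o, p, q} : Set V), (openGraph (Y' ∆ M₂)).Reachable x x' → x = x')) ∨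
        (((openGraph X').Reachable p q ∧ ¬ (openGraph X').Reachable o p ∧ ¬ (openGraph X').Reachable o q) ∧
          (∀ x ∈ ({o, p, q} : Set V), ∀ x' ∈ ({o, p, q} : Set V), (openGraph (X' ∆ M₁)).Reachable x x' → x = x') ∧
          (∀ x ∈ ({o, p, q} : Set V), ∀ x' ∈ ({o, p, q} : Set V), (openGraph Y').Reachable x x' → x = x') ∧
          ((openGraph (Y' ∆ M₂)).Reachable p q ∧ ¬ (openGraph (Y' ∆ M₂)).Reachable o p ∧ ¬ (openGraph (Y' ∆ M₂)).Reachable o q))) →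
      (X' ∪ G ∪ Y') \ M' = u₀ ∧ IsForestCfg (X' ∪ G ∪ Y') ∧ s(o, v) ∈ X' ∪ G ∪ Y' ∧ (X' ∪ G ∪ Y') ∈ Rset ∩ Res ∧
        IsForestCfg ((X' ∪ G ∪ Y') ∆ M') ∧ s(o, y) ∈ (X' ∪ G ∪ Y') ∆ M' := by
    intro ω X' G Y' hω hX hG hY hX' hY' hXF hXBF hYF hYBF heX hfY hgad htr
    obtain ⟨-, hdis, -, -, -⟩ := fib hω
    have hGsub : G ⊆ ES := by rw [hG]; exact inter_subset_right
    obtain ⟨c, c', hc, hc', hcc', hGc, hGc'⟩ := gadc hgad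
    rw [← hG] at hGc
    obtain ⟨gE1, gES, gE2, gB⟩ := glued hX hGsub hY
    have hfib := gluedFib hX hGsub hY hdis hX' hY'
    -- the colouring and its partner are forests
    have hWF : IsForestCfg (X' ∪ G ∪ Y') := by
      rw [hGc]
      refine pathGadget_reglue hop hoq hpq h₁ h₂ hS hd hn₁ hn₂ hX hY hXF hYF hc ?_
      rcases htr with ⟨a, -, b, -⟩ | ⟨a, -, b, -⟩
      · exact Or.inl ⟨a, b⟩
      · exact Or.inr ⟨a, b⟩
    have hWBF : IsForestCfg ((X' ∪ G ∪ Y') ∆ M') := by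
      refine isForestCfg_of_subset ?_ gB
      rw [hGc, hGc']
      refine pathGadget_reglue hop hoq hpq h₁ h₂ hS hd hn₁ hn₂ ?_ ?_ hXBF hYBF hc' ?_
      · intro x hx; rcases Set.mem_symmDiff.1 hx with ⟨h, -⟩ | ⟨h, -⟩; exacts [hX h, h.2]
      · intro x hx; rcases Set.mem_symmDiff.1 hx with ⟨h, -⟩ | ⟨h, -⟩; exacts [hY h, h.2]
      · rcases htr with ⟨-, a, -, b⟩ | ⟨-, a, -, b⟩
        · exact Or.inr ⟨a, b⟩
        · exact Or.inl ⟨a, b⟩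
    -- traces of the four parts: residual and doubly-`pq`
    have hB1 : ((X' ∪ G ∪ Y') ∆ M') ∩ E₁ = X' ∆ M₁ := by rw [part₁, gE1]
    have hB2 : ((X' ∪ G ∪ Y') ∆ M') ∩ E₂ = Y' ∆ M₂ := by rw [part₂, gE2]
    have hRW : (X' ∪ G ∪ Y') ∈ Rset := by
      rw [hRset, gE1, gE2, hB1, hB2]
      rcases htr with ⟨hXd, ⟨hB1pq, -, -⟩, ⟨hYpq, -, -⟩, hYBd⟩ | ⟨⟨hXpq, -, -⟩, hXBd, hYd, ⟨hYBpq, -, -⟩⟩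
      · exact ⟨fun h => hpq (hXd p hp3 q hq3 ((h p hp3 q hq3).2 hB1pq)), fun h => hpq (hYBd p hp3 q hq3 ((h p hp3 q hq3).1 hYpq))⟩
      · exact ⟨fun h => hpq (hXBd p hp3 q hq3 ((h p hp3 q hq3).1 hXpq)), fun h => hpq (hYd p hp3 q hq3 ((h p hp3 q hq3).2 hYBpq))⟩
    have hResW : (X' ∪ G ∪ Y') ∈ Res := by
      rw [hRes, gE1, gE2, hB1, hB2]
      rcases htr with ⟨-, ⟨hB1pq, -, -⟩, ⟨hYpq, -, -⟩, -⟩ | ⟨⟨hXpq, -, -⟩, -, -, ⟨hYBpq, -, -⟩⟩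
      · exact Or.inl ⟨hYpq, hB1pq⟩
      · exact Or.inr ⟨hXpq, hYBpq⟩
    refine ⟨hfib, hWF, Or.inl (Or.inl heX), ⟨hRW, hResW⟩, hWBF, ?_⟩
    exact Set.mem_symmDiff.2 (Or.inr ⟨hfM, fun h => by
      rcases h with (h | h) | h
      · exact Set.disjoint_left.1 hd (hX h) hfE
      · exact Set.disjoint_left.1 hES₂ (hGsub h) hfE
      · exact hfY h⟩)
  have main : ∀ ω : BondConfig V, ω \ M' = u₀ → IsForestCfg ω → s(o, v) ∈ ω → s(o, y) ∈ ω → ω ∈ Rset → ω ∈ Res →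
      IsForestCfg (ω ∆ M') →
      ((Θ ω) \ M' = u₀ ∧ IsForestCfg (Θ ω) ∧ s(o, v) ∈ Θ ω ∧ Θ ω ∈ Rset ∩ Res ∧ IsForestCfg ((Θ ω) ∆ M') ∧ s(o, y) ∈ (Θ ω) ∆ M') ∧
      (Θ ω) ∩ ES = ω ∩ ES ∧
      (((openGraph ((Θ ω) ∩ E₁)).Reachable p q ∧ (Θ ω) ∩ E₁ ∈ T₁ ∧ J₁ ((Θ ω) ∩ E₁) = ω ∩ E₁ ∧ ω ∩ E₂ = ((Θ ω) ∩ E₂) ∆ M₂) ∨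
       (¬ (openGraph ((Θ ω) ∩ E₁)).Reachable p q ∧ (∃ X, X ∈ T₁ ∧ J₁ X = (Θ ω) ∩ E₁) ∧ ω ∩ E₁ ∈ T₁ ∧ J₁ (ω ∩ E₁) = (Θ ω) ∩ E₁ ∧
          ω ∩ E₂ = ((Θ ω) ∩ E₂) ∆ M₂) ∨
       (¬ (openGraph ((Θ ω) ∩ E₁)).Reachable p q ∧ ¬ (∃ X, X ∈ T₁ ∧ J₁ X = (Θ ω) ∩ E₁) ∧ ω ∩ E₁ = (Θ ω) ∩ E₁ ∧ ω ∩ E₂ ∈ T₂ ∧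
          J₂ (ω ∩ E₂) = ((Θ ω) ∩ E₂) ∆ M₂)) := by
    intro ω hω hF he hf hRω hResω hFB
    obtain ⟨hωsub, hdis, hX₁fib, hX₂fib, hrecon⟩ := fib hω
    have hA₁F : IsForestCfg (ω ∩ E₁) := isForestCfg_of_subset hF inter_subset_left
    have hA₂F : IsForestCfg (ω ∩ E₂) := isForestCfg_of_subset hF inter_subset_left
    have hB₁F : IsForestCfg ((ω ∩ E₁) ∆ M₁) := by rw [← part₁]; exact isForestCfg_of_subset hFB inter_subset_left
    have hB₂F : IsForestCfg ((ω ∩ E₂) ∆ M₂) := by rw [← part₂]; exact isForestCfg_of_subset hFB inter_subset_left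
    have hB₂fib : ((ω ∩ E₂) ∆ M₂) \ M₂ = u₀ ∩ E₂ := by rw [symmDiff_sdiff_eq_of_subset (subset_refl _)]; exact hX₂fib
    have hB₂sub : (ω ∩ E₂) ∆ M₂ ⊆ E₂ := fun x hx => by
      rcases Set.mem_symmDiff.1 hx with ⟨h, -⟩ | ⟨h, -⟩; exacts [h.2, h.2]
    have hfB₂ : s(o, y) ∉ (ω ∩ E₂) ∆ M₂ := fun h => by
      rcases Set.mem_symmDiff.1 h with ⟨-, h⟩ | ⟨-, h⟩
      · exact h hfM₂
      · exact h ⟨hf, hfE⟩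
    have hB₂B : ((ω ∩ E₂) ∆ M₂) ∆ M₂ = ω ∩ E₂ := symmDiff_symmDiff_cancel_right _ _
    have hRes' := (hRes ω).1 hResω
    rw [part₁, part₂] at hRes'
    by_cases hC₂ : (openGraph (ω ∩ E₁)).Reachable p q
    · -- type `(pq, d | d, pq)`: re-glue `J₁ (ω ∩ E₁)` with the flipped side 2
      have hΘω : Θ ω = J₁ (ω ∩ E₁) ∪ ω ∩ ES ∪ (ω ∩ E₂) ∆ M₂ := by rw [hΘdef]; simp only [if_pos hC₂, part₂]
      have h2 : (openGraph (ω ∩ E₁)).Reachable p q ∧ (openGraph ((ω ∩ E₂) ∆ M₂)).Reachable p q := by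
        rcases hRes' with h | h
        · -- the other type is excluded: it makes `ω ∩ E₁` discrete
          have := (pathGadget_res_structure hop hoq hpq hd hn₁ hn₂ hgp hgq hF hFB h.1 (by rw [part₁]; exact h.2)).2.1
          exact absurd (this p hp3 q hq3 hC₂) hpq
        · exact h
      obtain ⟨hgad, hB₁d, hA₂d, nB₂op, nB₂oq, nA₁op, nA₁oq⟩ :=
        pathGadget_res_structure' hop hoq hpq hd hn₁ hn₂ hgp hgq hF hFB h2.1 (by rw [part₂]; exact h2.2)
      rw [part₁] at hB₁d; rw [part₂] at nB₂op nB₂oq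
      have hXT : ω ∩ E₁ ∈ T₁ := (hT₁ _).2 ⟨inter_subset_right, hX₁fib, hA₁F, hB₁F, ⟨he, heE⟩, ⟨hC₂, nA₁op, nA₁oq⟩, hB₁d⟩
      obtain ⟨hX'sub, hX'fib, hX'F, hX'BF, heX', hX'd, hX'Bpq⟩ := (hT₁' _).1 (hJ₁ _ hXT)
      obtain ⟨v1, v2, v3, v4, v5, v6⟩ := verify hω hX'sub rfl hB₂sub hX'fib hB₂fib hX'F hX'BF hB₂F (by rw [hB₂B]; exact hA₂F) heX' hfB₂
        hgad (Or.inl ⟨hX'd, hX'Bpq, ⟨h2.2, nB₂op, nB₂oq⟩, by rw [hB₂B]; exact hA₂d⟩)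
      obtain ⟨gE1, gES, gE2, -⟩ := glued hX'sub (inter_subset_right : ω ∩ ES ⊆ ES) hB₂sub
      rw [hΘω, gE1, gES, gE2]
      refine ⟨⟨v1, v2, v3, v4, v5, v6⟩, rfl, Or.inr (Or.inl ⟨fun h => hpq (hX'd p hp3 q hq3 h), ⟨_, hXT, rfl⟩, hXT, rfl, ?_⟩)⟩
      rw [hB₂B]
    · -- type `(d, pq | pq, d)`
      have h1 : (openGraph (ω ∩ E₂)).Reachable p q ∧ (openGraph ((ω ∩ E₁) ∆ M₁)).Reachable p q := by
        rcases hRes' with h | h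
        · exact h
        · exact absurd h.1 hC₂
      obtain ⟨hgad, hA₁d, hB₂d, nA₂op, nA₂oq, nB₁op, nB₁oq⟩ :=
        pathGadget_res_structure hop hoq hpq hd hn₁ hn₂ hgp hgq hF hFB h1.1 (by rw [part₁]; exact h1.2)
      rw [part₂] at hB₂d; rw [part₁] at nB₁op nB₁oq
      by_cases himg : ∃ X, X ∈ T₁ ∧ J₁ X = ω ∩ E₁
      · -- un-glue: replace side 1 by the `J₁`-preimage, flip side 2
        have hΘω : Θ ω = Classical.choose himg ∪ ω ∩ ES ∪ (ω ∩ E₂) ∆ M₂ := by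
          rw [hΘdef]; simp only [if_neg hC₂, dif_pos himg, part₂]
        obtain ⟨hX₀T, hX₀J⟩ := Classical.choose_spec himg
        obtain ⟨hX₀sub, hX₀fib, hX₀F, hX₀BF, heX₀, hX₀pq, hX₀Bd⟩ := (hT₁ _).1 hX₀T
        obtain ⟨v1, v2, v3, v4, v5, v6⟩ := verify hω hX₀sub rfl hB₂sub hX₀fib hB₂fib hX₀F hX₀BF hB₂F (by rw [hB₂B]; exact hA₂F) heX₀
          hfB₂ hgad (Or.inr ⟨hX₀pq, hX₀Bd, hB₂d, by rw [hB₂B]; exact ⟨h1.1, nA₂op, nA₂oq⟩⟩)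
        obtain ⟨gE1, gES, gE2, -⟩ := glued hX₀sub (inter_subset_right : ω ∩ ES ⊆ ES) hB₂sub
        rw [hΘω, gE1, gES, gE2]
        exact ⟨⟨v1, v2, v3, v4, v5, v6⟩, rfl, Or.inl ⟨hX₀pq.1, hX₀T, hX₀J, by rw [hB₂B]⟩⟩
      · -- re-glue the flipped `J₂` of side 2
        have hΘω : Θ ω = ω ∩ E₁ ∪ ω ∩ ES ∪ (J₂ (ω ∩ E₂)) ∆ M₂ := by
          rw [hΘdef]; simp only [if_neg hC₂, dif_neg himg]
        have hYT : ω ∩ E₂ ∈ T₂ := (hT₂ _).2 ⟨inter_subset_right, hX₂fib, hA₂F, hB₂F, ⟨hf, hfE⟩, ⟨h1.1, nA₂op, nA₂oq⟩, hB₂d⟩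
        obtain ⟨hY'sub, hY'fib, hY'F, hY'BF, hfY', hY'd, hY'Bpq⟩ := (hT₂' _).1 (hJ₂ _ hYT)
        have hZsub : (J₂ (ω ∩ E₂)) ∆ M₂ ⊆ E₂ := fun x hx => by
          rcases Set.mem_symmDiff.1 hx with ⟨h, -⟩ | ⟨h, -⟩; exacts [hY'sub h, h.2]
        have hZfib : ((J₂ (ω ∩ E₂)) ∆ M₂) \ M₂ = u₀ ∩ E₂ := by rw [symmDiff_sdiff_eq_of_subset (subset_refl _)]; exact hY'fib
        have hZZ : ((J₂ (ω ∩ E₂)) ∆ M₂) ∆ M₂ = J₂ (ω ∩ E₂) := symmDiff_symmDiff_cancel_right _ _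
        have hfZ : s(o, y) ∉ (J₂ (ω ∩ E₂)) ∆ M₂ := fun h => by
          rcases Set.mem_symmDiff.1 h with ⟨-, h⟩ | ⟨-, h⟩
          · exact h hfM₂
          · exact h hfY'
        obtain ⟨v1, v2, v3, v4, v5, v6⟩ := verify hω (inter_subset_right : ω ∩ E₁ ⊆ E₁) rfl hZsub hX₁fib hZfib hA₁F hB₁F hY'BF
          (by rw [hZZ]; exact hY'F) ⟨he, heE⟩ hfZ hgad (Or.inl ⟨hA₁d, ⟨h1.2, nB₁op, nB₁oq⟩, hY'Bpq, by rw [hZZ]; exact hY'd⟩)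
        obtain ⟨gE1, gES, gE2, -⟩ := glued (inter_subset_right : ω ∩ E₁ ⊆ E₁) (inter_subset_right : ω ∩ ES ⊆ ES) hZsub
        rw [hΘω, gE1, gES, gE2]
        exact ⟨⟨v1, v2, v3, v4, v5, v6⟩, rfl, Or.inr (Or.inr ⟨hC₂, himg, rfl, hYT, by rw [hZZ]⟩)⟩
  refine fibreCount_le_of_injOn Θ (fun ω hω hA hB => ?_) (fun ω ω' hω₁ hA hFB hω₁' hA' hFB' hΘ => ?_)
  · obtain ⟨⟨hF, he, hf⟩, hRω, hResω⟩ := hA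
    obtain ⟨⟨v1, v2, v3, v4, v5, v6⟩, -, -⟩ := main ω hω hF he hf hRω hResω hB
    exact ⟨v1, ⟨⟨v2, v3⟩, v4⟩, v5, v6⟩
  · obtain ⟨⟨hF, he, hf⟩, hRω, hResω⟩ := hA
    obtain ⟨⟨hF', he', hf'⟩, hRω', hResω'⟩ := hA'
    obtain ⟨-, hS₁, hcase⟩ := main ω hω₁ hF he hf hRω hResω hFB
    obtain ⟨-, hS₂, hcase'⟩ := main ω' hω₁' hF' he' hf' hRω' hResω' hFB'
    obtain ⟨-, -, -, -, hrecon⟩ := fib hω₁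
    obtain ⟨-, -, -, -, hrecon'⟩ := fib hω₁'
    have hES' : ω ∩ ES = ω' ∩ ES := by rw [← hS₁, ← hS₂, hΘ]
    rw [hΘ] at hcase
    have key : ω ∩ E₁ = ω' ∩ E₁ ∧ ω ∩ E₂ = ω' ∩ E₂ := by
      rcases hcase with ⟨hr, hXT, hJ, h2⟩ | ⟨hr, hex, hXT, hJ, h2⟩ | ⟨hr, hex, h1, hYT, hJ⟩ <;>
        rcases hcase' with ⟨hr', hXT', hJ', h2'⟩ | ⟨hr', hex', hXT', hJ', h2'⟩ | ⟨hr', hex', h1', hYT', hJ'⟩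
      · exact ⟨by rw [← hJ, ← hJ'], by rw [h2, h2']⟩
      · exact absurd hr hr'
      · exact absurd hr hr'
      · exact absurd hr' hr
      · exact ⟨hJ₁i hXT hXT' (by rw [hJ, hJ']), by rw [h2, h2']⟩
      · exact absurd hex hex'
      · exact absurd hr' hr
      · exact absurd hex' hex
      · exact ⟨by rw [h1, h1'], hJ₂i hYT hYT' (by rw [hJ, hJ'])⟩
    rw [hrecon, hrecon', key.1, key.2, hES']

end PathGadgetProduct

end FK

end Summit.CriticalPhenomena.PercolationContinuityZ3.Theorems

end
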